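import Mathlib

/-!
# Route «KPlusLogSqLaw», crux `TropicalB` (stmt-ValiantsHypothesis-19771) — THE CYCLE POTENTIAL LAW, part 1: LACUNARY TRANSFER
# (all `c`-lacunary weightings order class multisets of size `≤ c` alike; the rank re-weighting `(c+1)^rank`)

HONEST FRAMING.  Helper toward the registered stubs `stub_tropThin` / `stub_tropFat` of `Cruxes/TropicalB/Lines/birth.lean` (crux
`Summit.ValiantsHypothesis.ValiantsHypothesis.Theses.KPlusLogSqLaw.TropicalB`, item stmt-ValiantsHypothesis-19771, route KPlusLogSqLaw;
cell `pub-symmetroid`, seat val-sym-trop-p1 g24, 2026-08-29; `--supports … --as helper`).  Pure combinatorics of count vectors consumed by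
part 2 (`…TropicalBCyclePotential`: in ANY design, a dominant chain whose exchange orbits have `≤ c` columns climbs every `c`-compatible class
potential by one per step).  Nothing here mentions a design; nothing bears on `TropicalB` in its window, `WeakLifting`, DoorA26 / DoorA34,
`MatrixDescartes` (stmt-ValiantsHypothesis-18050) or VP ≠ VNP.

* `lacunary_transfer` — on a finite value set `S` let `α`, `β : ℕ → ℕ` be `c`-LACUNARY (`W' < W ⇒ c·α W' < α W`).  For count functions
  `F, G` on `S` with equal totals `≤ c`:  `Σ_S α·F < Σ_S α·G ⇒ Σ_S β·F < Σ_S β·G`.  (Peel the maximum `a` of `S`: if `F a = G a` induct; if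
  `F a < G a` the extra copy of `β a` beats the `≤ c` items of weight `< β a / c` that `F` has below; if `F a > G a` the same with `α`
  contradicts the hypothesis.)  So ALL `c`-lacunary weightings induce ONE strict order on pairs of count vectors of total `≤ c`.
* `col_transfer` — column form: exponents `d` with `c`-lacunary VALUES (`d l < d l' ⇒ c·d l < d l'`) and any `φ` that is `c`-lacunary on
  them: on a column set `B` with `#B ≤ c`, `Σ_B d∘f < Σ_B d∘g ⇒ Σ_B φ∘d∘f < Σ_B φ∘d∘g` for all class maps `f, g`.
* `rank_lt_rank`, `rank_le`, `rankPow_lacunary`, `exists_compatible_potential` — the rank re-weighting `W ↦ (c+1)^(#values of d below W)`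
  is `c`-lacunary for EVERY `d` and takes values in `[1, (c+1)^(K−1)]`; hence for `c`-lacunary `d` there is a `c`-COMPATIBLE class potential
  `u` (`Σ_B d∘f < Σ_B d∘g ⇒ Σ_B u∘f < Σ_B u∘g` on `#B ≤ c`, integer form) of height `(c+1)^(K−1) − 1`.  No definition is introduced.
[this file]
-/

set_option linter.dupNamespace false
set_option autoImplicit false

namespace Summit.ValiantsHypothesis.ValiantsHypothesis.Theorems.KPlusLogSqLaw

open scoped BigOperators
open Finset

namespace CyclePotential

/-! ## 1. Lacunary transfer: all `c`-lacunary weightings order small count vectors alike -/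

/-- the absorption trick: `c·X + t ≤ γ·t` with `1 ≤ t ≤ c` forces `X < γ`. [this file] -/
theorem lt_of_absorb {c X t γ : ℕ} (h : c * X + t ≤ γ * t) (ht1 : 1 ≤ t) (htc : t ≤ c) : X < γ := by
  by_contra hX
  push Not at hX
  have h1 : c * γ ≤ c * X := Nat.mul_le_mul_left c hX
  have h2 : γ * t ≤ γ * c := Nat.mul_le_mul_left γ htc
  have h3 : c * γ + t ≤ γ * c := by
    calc c * γ + t ≤ c * X + t := Nat.add_le_add_right h1 t
      _ ≤ γ * t := h
      _ ≤ γ * c := h2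
  have h4 : γ * c = c * γ := Nat.mul_comm _ _
  omega

/-- weighted count below a dominating weight: if `c·γ W + 1 ≤ Γ` for every `W ∈ s` then
`c·(Σ_s γ W · G W) + Σ_s G W ≤ Γ · Σ_s G W`. [this file] -/
theorem weighted_le_of_dominating (c Γ : ℕ) (γ G : ℕ → ℕ) (s : Finset ℕ) (hs : ∀ W ∈ s, c * γ W + 1 ≤ Γ) :
    c * (∑ W ∈ s, γ W * G W) + ∑ W ∈ s, G W ≤ Γ * ∑ W ∈ s, G W := by
  rw [mul_sum, ← sum_add_distrib, mul_sum]
  refine sum_le_sum fun W hW => ?_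
  have h := hs W hW
  calc c * (γ W * G W) + G W = (c * γ W + 1) * G W := by ring
    _ ≤ Γ * G W := Nat.mul_le_mul_right _ h

/-- **Lacunary transfer.**  On a finite value set `S`, let `α` and `β` be `c`-LACUNARY (`W' < W ⇒ c·α W' < α W`, same for `β`).
Then for count functions `F, G` with equal totals `≤ c` on `S`:  `Σ_S α·F < Σ_S α·G ⇒ Σ_S β·F < Σ_S β·G`.
Proof: peel the maximum `a` of `S`.  If `F a = G a`, induct.  If `F a < G a`, the extra copy of `β a` on the `G` side beats
everything `F` has below (`c` items of weight `< β a / c`).  If `F a > G a`, the same with `α` contradicts the hypothesis. [this file] -/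
theorem lacunary_transfer (c : ℕ) (α β : ℕ → ℕ) (S : Finset ℕ)
    (hα : ∀ W ∈ S, ∀ W' ∈ S, W' < W → c * α W' < α W)
    (hβ : ∀ W ∈ S, ∀ W' ∈ S, W' < W → c * β W' < β W)
    (F G : ℕ → ℕ) (htot : ∑ W ∈ S, F W = ∑ W ∈ S, G W) (hc : ∑ W ∈ S, G W ≤ c)
    (hlt : ∑ W ∈ S, α W * F W < ∑ W ∈ S, α W * G W) :
    ∑ W ∈ S, β W * F W < ∑ W ∈ S, β W * G W := by
  revert hα hβ F G
  induction S using Finset.induction_on_max with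
  | empty =>
    intro _ _ F G _ _ hlt
    simp at hlt
  | insert a s ha ih =>
    intro hα hβ F G htot hc hlt
    have has : a ∉ s := fun h => lt_irrefl a (ha a h)
    simp only [sum_insert has] at htot hc hlt ⊢
    -- lacunarity restricted to `s`, and domination of `s` by `a`
    have hαs : ∀ W ∈ s, ∀ W' ∈ s, W' < W → c * α W' < α W :=
      fun W hW W' hW' h => hα W (mem_insert_of_mem hW) W' (mem_insert_of_mem hW') h
    have hβs : ∀ W ∈ s, ∀ W' ∈ s, W' < W → c * β W' < β W :=
      fun W hW W' hW' h => hβ W (mem_insert_of_mem hW) W' (mem_insert_of_mem hW') h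
    have hαa : ∀ W ∈ s, c * α W + 1 ≤ α a :=
      fun W hW => hα a (mem_insert_self a s) W (mem_insert_of_mem hW) (ha W hW)
    have hβa : ∀ W ∈ s, c * β W + 1 ≤ β a :=
      fun W hW => hβ a (mem_insert_self a s) W (mem_insert_of_mem hW) (ha W hW)
    have hBG := weighted_le_of_dominating c (α a) α G s hαa
    have hBF := weighted_le_of_dominating c (β a) β F s hβa
    rcases lt_trichotomy (F a) (G a) with hFG | hFG | hFG
    · -- `F a < G a`: conclude directly
      have htF1 : 1 ≤ ∑ W ∈ s, F W := by omega
      have htFc : ∑ W ∈ s, F W ≤ c := by omega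
      have hY : ∑ W ∈ s, β W * F W < β a := lt_of_absorb hBF htF1 htFc
      have h1 : β a * F a + β a ≤ β a * G a := by
        have : F a + 1 ≤ G a := hFG
        calc β a * F a + β a = β a * (F a + 1) := by ring
          _ ≤ β a * G a := Nat.mul_le_mul_left _ this
      calc β a * F a + ∑ W ∈ s, β W * F W < β a * F a + β a := by omega
        _ ≤ β a * G a := h1
        _ ≤ β a * G a + ∑ W ∈ s, β W * G W := Nat.le_add_right _ _
    · -- `F a = G a`: induction
      rw [hFG] at htot hlt ⊢
      have htot' : ∑ W ∈ s, F W = ∑ W ∈ s, G W := by omega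
      have hc' : ∑ W ∈ s, G W ≤ c := by omega
      have hlt' : ∑ W ∈ s, α W * F W < ∑ W ∈ s, α W * G W := by omega
      have := ih hαs hβs F G htot' hc' hlt'
      omega
    · -- `F a > G a`: contradiction with the `α`-inequality
      exfalso
      have htG1 : 1 ≤ ∑ W ∈ s, G W := by omega
      have htGc : ∑ W ∈ s, G W ≤ c := by omega
      have hX : ∑ W ∈ s, α W * G W < α a := lt_of_absorb hBG htG1 htGc
      have h1 : α a * G a + α a ≤ α a * F a := by
        have : G a + 1 ≤ F a := hFG
        calc α a * G a + α a = α a * (G a + 1) := by ring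
          _ ≤ α a * F a := Nat.mul_le_mul_left _ this
      omega

/-! ## 2. Column form: `c`-lacunary exponents make every `c`-lacunary re-weighting `c`-compatible -/

/-- a class-map sum as a weighted count over the value set. [folklore] -/
theorem sum_eq_weighted_count {ι : Type*} {K : ℕ} (d : Fin K → ℕ) (ψ : ℕ → ℕ) (B : Finset ι) (f : ι → Fin K)
    (S : Finset ℕ) (hS : ∀ b ∈ B, d (f b) ∈ S) :
    ∑ b ∈ B, ψ (d (f b)) = ∑ W ∈ S, ψ W * (B.filter fun b => d (f b) = W).card := by
  classical
  rw [← sum_fiberwise_of_maps_to hS]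
  refine sum_congr rfl fun W _ => ?_
  rw [sum_congr rfl fun b hb => by rw [(mem_filter.mp hb).2], sum_const, smul_eq_mul, Nat.mul_comm]

/-- **Column transfer.**  If the exponent values are `c`-lacunary (`d l < d l' ⇒ c·d l < d l'`) and `φ` is `c`-lacunary on them
(`d l < d l' ⇒ c·φ (d l) < φ (d l')`), then on every column set `B` with `#B ≤ c` and all class maps `f g`:
`Σ_B d∘f < Σ_B d∘g ⇒ Σ_B φ∘d∘f < Σ_B φ∘d∘g`. [this file] -/
theorem col_transfer {ι : Type*} {K : ℕ} (c : ℕ) (d : Fin K → ℕ) (hd : ∀ l l', d l < d l' → c * d l < d l')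
    (φ : ℕ → ℕ) (hφ : ∀ l l', d l < d l' → c * φ (d l) < φ (d l'))
    (B : Finset ι) (hB : B.card ≤ c) (f g : ι → Fin K)
    (hlt : ∑ b ∈ B, d (f b) < ∑ b ∈ B, d (g b)) :
    ∑ b ∈ B, φ (d (f b)) < ∑ b ∈ B, φ (d (g b)) := by
  classical
  set S : Finset ℕ := B.image (fun b => d (f b)) ∪ B.image (fun b => d (g b)) with hS_def
  have hSf : ∀ b ∈ B, d (f b) ∈ S := fun b hb => mem_union_left _ (mem_image_of_mem _ hb)
  have hSg : ∀ b ∈ B, d (g b) ∈ S := fun b hb => mem_union_right _ (mem_image_of_mem _ hb)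
  -- every element of `S` is an exponent value
  have hSval : ∀ W ∈ S, ∃ l, d l = W := by
    intro W hW
    rcases mem_union.mp hW with h | h
    · obtain ⟨b, _, hb⟩ := mem_image.mp h; exact ⟨f b, hb⟩
    · obtain ⟨b, _, hb⟩ := mem_image.mp h; exact ⟨g b, hb⟩
  set F : ℕ → ℕ := fun W => (B.filter fun b => d (f b) = W).card
  set G : ℕ → ℕ := fun W => (B.filter fun b => d (g b) = W).card
  have hF : ∀ ψ : ℕ → ℕ, ∑ b ∈ B, ψ (d (f b)) = ∑ W ∈ S, ψ W * F W :=
    fun ψ => sum_eq_weighted_count d ψ B f S hSf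
  have hG : ∀ ψ : ℕ → ℕ, ∑ b ∈ B, ψ (d (g b)) = ∑ W ∈ S, ψ W * G W :=
    fun ψ => sum_eq_weighted_count d ψ B g S hSg
  have htotF : ∑ W ∈ S, F W = B.card := (card_eq_sum_card_fiberwise hSf).symm
  have htotG : ∑ W ∈ S, G W = B.card := (card_eq_sum_card_fiberwise hSg).symm
  have hα : ∀ W ∈ S, ∀ W' ∈ S, W' < W → c * (fun x => x) W' < (fun x => x) W := by
    intro W hW W' hW' h
    obtain ⟨l, rfl⟩ := hSval W hW
    obtain ⟨l', rfl⟩ := hSval W' hW'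
    exact hd l' l h
  have hβ : ∀ W ∈ S, ∀ W' ∈ S, W' < W → c * φ W' < φ W := by
    intro W hW W' hW' h
    obtain ⟨l, rfl⟩ := hSval W hW
    obtain ⟨l', rfl⟩ := hSval W' hW'
    exact hφ l' l h
  have hlt' : ∑ W ∈ S, (fun x => x) W * F W < ∑ W ∈ S, (fun x => x) W * G W := by
    have h1 := hF fun x => x
    have h2 := hG fun x => x
    simp only at h1 h2 ⊢
    rw [← h1, ← h2]; exact hlt
  have key := lacunary_transfer c (fun x => x) φ S hα hβ F G (by rw [htotF, htotG]) (by rw [htotG]; exact hB) hlt'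
  rw [hF φ, hG φ]
  exact key

/-! ### The rank re-weighting `(c+1)^{rank}` (no auxiliary definition: `rank W = #{values of d below W}`) -/

/-- ranks strictly increase along the exponent values. [this file] -/
theorem rank_lt_rank {K : ℕ} (d : Fin K → ℕ) {l l' : Fin K} (h : d l < d l') :
    (((univ : Finset (Fin K)).image d).filter fun W' => W' < d l).card + 1 ≤
      (((univ : Finset (Fin K)).image d).filter fun W' => W' < d l').card := by
  have hsub : (((univ : Finset (Fin K)).image d).filter fun W' => W' < d l) ⊂
      (((univ : Finset (Fin K)).image d).filter fun W' => W' < d l') := by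
    rw [Finset.ssubset_iff_subset_ne]
    refine ⟨fun W hW => ?_, fun heq => ?_⟩
    · rw [mem_filter] at hW ⊢
      exact ⟨hW.1, hW.2.trans h⟩
    · have hmem : d l ∈ (((univ : Finset (Fin K)).image d).filter fun W' => W' < d l') :=
        mem_filter.mpr ⟨mem_image_of_mem _ (mem_univ l), h⟩
      rw [← heq, mem_filter] at hmem
      exact lt_irrefl _ hmem.2
  exact card_lt_card hsub

/-- the rank is at most `K − 1`. [this file] -/
theorem rank_le {K : ℕ} (d : Fin K → ℕ) (l : Fin K) :
    (((univ : Finset (Fin K)).image d).filter fun W' => W' < d l).card ≤ K - 1 := by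
  have hsub : (((univ : Finset (Fin K)).image d).filter fun W' => W' < d l) ⊆ ((univ : Finset (Fin K)).image d).erase (d l) := by
    intro W hW
    rw [mem_filter] at hW
    exact mem_erase.mpr ⟨hW.2.ne, hW.1⟩
  have h1 := card_le_card hsub
  rw [card_erase_of_mem (mem_image_of_mem _ (mem_univ l))] at h1
  have h2 : ((univ : Finset (Fin K)).image d).card ≤ K :=
    card_image_le.trans (by rw [card_univ, Fintype.card_fin])
  omega

/-- the rank re-weighting `W ↦ (c+1)^(rank W)` is `c`-lacunary on the exponent values (no hypothesis on `d`). [this file] -/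
theorem rankPow_lacunary {K : ℕ} (c : ℕ) (d : Fin K → ℕ) (l l' : Fin K) (h : d l < d l') :
    c * (c + 1) ^ (((univ : Finset (Fin K)).image d).filter fun W' => W' < d l).card <
      (c + 1) ^ (((univ : Finset (Fin K)).image d).filter fun W' => W' < d l').card := by
  have h1 := rank_lt_rank d h
  set r := (((univ : Finset (Fin K)).image d).filter fun W' => W' < d l).card
  have h2 : (c + 1) ^ (r + 1) ≤ (c + 1) ^ (((univ : Finset (Fin K)).image d).filter fun W' => W' < d l').card :=
    Nat.pow_le_pow_right (Nat.succ_pos c) h1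
  have h3 : c * (c + 1) ^ r < (c + 1) ^ (r + 1) := by
    rw [pow_succ]
    have : 0 < (c + 1) ^ r := Nat.pow_pos (Nat.succ_pos c)
    nlinarith
  exact lt_of_lt_of_le h3 h2

/-- **A `c`-compatible potential of height `(c+1)^(K−1) − 1` for `c`-lacunary exponents.**  If `d l < d l' ⇒ c·d l < d l'`, there is a class
potential `u : Fin K → ℤ` with `1 ≤ u ≤ (c+1)^(K−1)` such that on every column set `B` with `#B ≤ c` and for all class maps `f, g`:
`Σ_B d∘f < Σ_B d∘g ⇒ Σ_B u∘f < Σ_B u∘g` (namely `u = (c+1)^rank ∘ d`). [this file] -/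
theorem exists_compatible_potential {m K : ℕ} (c : ℕ) (d : Fin K → ℕ) (hd : ∀ l l', d l < d l' → c * d l < d l') :
    ∃ u : Fin K → ℤ, (∀ l, 1 ≤ u l ∧ u l ≤ (((c + 1) ^ (K - 1) : ℕ) : ℤ)) ∧
      ∀ B : Finset (Fin m), B.card ≤ c → ∀ f g : Fin m → Fin K,
        ∑ b ∈ B, (d (f b) : ℤ) < ∑ b ∈ B, (d (g b) : ℤ) → ∑ b ∈ B, u (f b) < ∑ b ∈ B, u (g b) := by
  refine ⟨fun l => (((c + 1) ^ (((univ : Finset (Fin K)).image d).filter fun W' => W' < d l).card : ℕ) : ℤ),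
    fun l => ⟨?_, ?_⟩, ?_⟩
  · dsimp only
    exact_mod_cast Nat.one_le_pow _ _ (Nat.succ_pos c)
  · dsimp only
    exact_mod_cast Nat.pow_le_pow_right (Nat.succ_pos c) (rank_le d l)
  · intro B hB f g hlt
    have hlt' : ∑ b ∈ B, d (f b) < ∑ b ∈ B, d (g b) := by exact_mod_cast hlt
    have h := col_transfer c d hd (fun W => (c + 1) ^ (((univ : Finset (Fin K)).image d).filter fun W' => W' < W).card)
      (fun l l' hll' => rankPow_lacunary c d l l' hll') B hB f g hlt'
    dsimp only at h ⊢
    exact_mod_cast h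

end CyclePotential

end Summit.ValiantsHypothesis.ValiantsHypothesis.Theorems.KPlusLogSqLaw
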